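import Summits.QuantumFields.YangMills.Theorems.SmallFieldWideningLargeFieldMassRefinementTailLocalAveragedPlaquette
import Literature.MathematicalPhysics.QuantumFieldTheory.Balaban1983to89.T3FinestHeightTail
import Literature.MathematicalPhysics.QuantumFieldTheory.Balaban1983to89.T3ThresholdSmallness
import Literature.MathematicalPhysics.QuantumFieldTheory.Balaban1983to89.T3LevelShift
import HarnessLib

/-!
# Route `SmallFieldWidening`, crux r3 `LargeFieldMassRefinementTail` (stmt-QuantumFields-22884), line `birth` — support file:
# THE (base) CONJUNCT OF THE REGISTERED STUB `stub_localStepFloor` AT THE FIRST RUN `k₀ = 1`, PROVED — the unit-plaquette tail of the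
# ONE-STEP (0.4)-averaged `SU(2)` field under the Wilson–Gibbs law, UNIFORMLY IN THE VOLUME

Width seat `ym-line-sfw-p2-w2` (gen 47).  WHAT.  ★ `avgPlaq_tail_threshold` (the master bound): there is `c > 0` (the Haar small-ball
constant of the tree's chessboard tail) such that for EVERY family `F` (ANY volume exponent `m`), every `0 < γ ≤ 1`, every coarse plaquette
`q` of run `1` and every threshold `0 ≤ θ ≤ 8`,

  `Gibbs_1{U : θ ≤ |Ū¹(∂q) − 1|} ≤ 3(12L+1)³ · 2e²⁴c⁻³ · (√β₁)⁹ · exp(−β₁ (θ/(151L²))² / 4)`,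

`Ū¹ = blockAvg ℰp U` the one-step (0.4) average, `β₁ = L/γ` the inverse coupling of run `1`.
★ `avgPlaq_tail_firstRun`: with Bałaban's unit threshold `θ = t·θ(0)`, `θ(0) = √γ·p(√γ)` (`θBal … 0`), `t ∈ [1/2,1]`, `γ ≤ γ₁(L,b₀,p₀)`:
`≤ C_b · γ^{−5} · exp(−c_b · p(√γ)²)`, `c_b = L/(16·(151L²)²)`.  ★★ `baseClause_firstRun`: the same in the letters of the stub
(`Averaging.iter … 1`, `plaqShift (F.sitesPerDir_unit 1) q`), i.e. the (base) conjunct of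
`Cruxes/LargeFieldMassRefinementTail/Lines/birth.lean :: stub_localStepFloor` for a supplier choosing `k₀ = 1` (its `c_b` must not
depend on the precision `η`; here it depends on `L` only, `C_b, γ₁` on `L, b₀, p₀`).
PROOF (energy-only, fixed height).  If every fine plaquette cornered in the `6L`-box around the block centre `emb q₋` is within
`a₀ := θ/(151L²)` of `1`, the LOCAL crude Prop 1 (`…LocalAveragedPlaquette.dist1_plaqHol_blockAvg_lt_loc`, guard
`(25L²/4)a₀ = 25θ/604 < 1/3 ≤ δ_{SU(2)}` for `θ ≤ 8`) gives `|Ū¹(∂q) − 1| < θ`; so the event lies in the union over the `≤ 3·(12L+1)³`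
box plaquettes `q′` of `{a₀ ≤ |U(∂q′) − 1|}`, each of Gibbs mass `≤ 2e^{24}c⁻³(√β₁)⁹e^{−β₁a₀²/4}` (tree
`T3FinestHeightTail.gibbsMeasure_real_dist1_ge_le`, chessboard/RP).  For `θ = tθ(0) ≤ 1` (`γ ≤ γ₁` by `exists_forall_θBal_le`):
`β₁a₀²/4 = L t² p(√γ)²/(4·(151L²)²) ≥ c_b p(√γ)²` and `(√β₁)⁹ ≤ β₁⁵ = L⁵γ^{−5}`.
WHAT THIS IS NOT.  Fixed height only (constants blow up with the height: the record's §25/§32 «energy-only methods certify the heights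
j < j*»); it does NOT touch the (step) conjunct of `stub_localStepFloor` (the cutoff-uniform event-level one-step comparison, open in
print) and does not revive line `birth`; cruxes 22884 / 27718 stay OPEN; rung R3 is a RECORD rung; the YM mass gap is NOT proved by any
of this.
-/

noncomputable section

namespace Summit.QuantumFields.YangMills.Theorems.LargeFieldMassRefinementTailBaseTail

open MeasureTheory
open scoped BigOperators
open Literature.MathematicalPhysics.QuantumFieldTheory.Balaban1983to89
open Literature.MathematicalPhysics.QuantumFieldTheory.Balaban1983to89.T3ContinuumYM3Torus
open Literature.MathematicalPhysics.QuantumFieldTheory.Balaban1983to89.T3UnitScaleTilt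
open Literature.MathematicalPhysics.QuantumFieldTheory.Balaban1983to89.T3UnitLawDensityEML (ℰp)
open Literature.MathematicalPhysics.QuantumFieldTheory.Balaban1983to89.T3LevelShift
open Literature.MathematicalPhysics.QuantumFieldTheory.Balaban1983to89.T3FinestHeightTail (gibbsMeasure_real_dist1_ge_le)
open Literature.MathematicalPhysics.QuantumFieldTheory.Balaban1983to89.T3ThresholdSmallness (exists_forall_θBal_le)
open Literature.MathematicalPhysics.QuantumFieldTheory.Balaban1983to89.T4Continuum
open Literature.MathematicalPhysics.QuantumFieldTheory.Balaban1983to89.BlockAveraging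
open Literature.MathematicalPhysics.QuantumFieldTheory.Balaban1983to89.ExpMeanLog (deltaSU)
open Summit.QuantumFields.YangMills.Theorems.LocalAveragedPlaquette

/-- `δ_{SU(2)} = min(1/3, π/2) ≥ 1/3`. [folklore] -/
private theorem third_le_deltaSU_two : (1 : ℝ) / 3 ≤ deltaSU (Fin 2) := by
  unfold deltaSU
  rw [Fintype.card_fin]
  refine le_min le_rfl ?_
  push_cast
  linarith [Real.pi_gt_three]

/-- ★ **THE UNIT-PLAQUETTE TAIL OF THE ONE-STEP (0.4)-AVERAGED FIELD AT ANY THRESHOLD `θ ∈ [0, 8]`, VOLUME-UNIFORM** (`SU(2)`,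
`d = 3`, run `1` of Bałaban's families, `β₁ = (γL⁻¹)⁻¹`): with the Haar small-ball constant `c > 0` of the tree's chessboard tail, for
every family, every `0 < γ ≤ 1`, every coarse plaquette `q` and every `0 ≤ θ ≤ 8`,
`Gibbs_1{θ ≤ |Ū¹(∂q) − 1|} ≤ 3(12L+1)³·2e²⁴c⁻³·(√β₁)⁹·exp(−β₁(θ/(151L²))²/4)` — contrapositive of the LOCAL crude Prop 1 (guard
`25θ/604 < 1/3`), union over the box plaquettes, the single-plaquette tail. [cite: Balaban1985UV3, (11) p.258 and (71) p.273; Balaban1985Averaging, Prop. 1 (51) p.26] -/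
theorem avgPlaq_tail_threshold :
    ∃ c : ℝ, 0 < c ∧ ∀ (F : T3Family) (γ : ℝ), 0 < γ → γ ≤ 1 → ∀ (q : Plaq (F.P 1) 1) (θ : ℝ), 0 ≤ θ → θ ≤ 8 →
      (gibbsK F ℰp γ 1).real {U | θ ≤ GaugeGroup.dist1 (GaugeField.plaqHol
          (Averaging.iter (fun i => BlockAveraging.blockAvg (P := F.P 1) (j := i) ℰp) 1 U) q)} ≤
        (((2 * (6 * F.L) + 1) ^ 3 * 3 : ℕ) : ℝ) * (2 * Real.exp 24 * (c ^ 3)⁻¹) *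
          Real.sqrt ((F.scheme ℰp γ).β 1) ^ 9 *
            Real.exp (-((F.scheme ℰp γ).β 1 * (θ / (151 * (F.L : ℝ) ^ 2)) ^ 2 / 4)) := by
  classical
  obtain ⟨c, hc, _hc1, htail⟩ := gibbsMeasure_real_dist1_ge_le (N := 2)
  refine ⟨c, hc, fun F γ hγ hγ1 q θ hθ0 hθ8 => ?_⟩
  haveI := isProbabilityMeasure_gibbsK F ℰp hγ.le 1
  have hL : 1 < F.L := F.hL.2
  have hL0 : (0 : ℝ) < F.L := by exact_mod_cast (zero_lt_one.trans hL)
  have hL1 : (1 : ℝ) ≤ F.L := by exact_mod_cast hL.le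
  have hC0 : (0 : ℝ) < 151 * (F.L : ℝ) ^ 2 := by positivity
  have ha0 : 0 ≤ θ / (151 * (F.L : ℝ) ^ 2) := by positivity
  -- the inverse coupling of run `1` is at least `1`
  have hβL : (F.scheme ℰp γ).β 1 = F.L / γ := by
    rw [show (F.scheme ℰp γ).β 1 = (γ * ((F.L : ℝ)⁻¹) ^ 1)⁻¹ from rfl]
    field_simp
  have hβ1 : 1 ≤ (F.scheme ℰp γ).β 1 := by
    rw [hβL, le_div_iff₀ hγ]; linarith
  -- THE BOX OF FINE PLAQUETTES around the block centre `emb q₋` (radius `6L`) as a finite set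
  set x : Site (F.P 1) 0 := emb q.src with hx
  set S : Finset (Plaq (F.P 1) 0) := (Finset.univ : Finset ((Fin (F.P 1).d → Fin (2 * (6 * F.L) + 1)) ×
      {μν : Fin (F.P 1).d × Fin (F.P 1).d // μν.1 < μν.2})).image
    (fun z => ⟨fun ν => x ν + ((((z.1 ν : ℕ) : ℤ) - (6 * F.L : ℕ) : ℤ) : ZMod ((F.P 1).sitesPerDir 0)),
      z.2.1.1, z.2.1.2, z.2.2⟩) with hS
  have hScard : (S.card : ℝ) ≤ (((2 * (6 * F.L) + 1) ^ 3 * 3 : ℕ) : ℝ) := by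
    have hpairs : Fintype.card {μν : Fin (F.P 1).d × Fin (F.P 1).d // μν.1 < μν.2} = 3 := by
      rw [show (F.P 1).d = 3 from rfl]; decide
    have h := (Finset.card_image_le (s := (Finset.univ : Finset ((Fin (F.P 1).d → Fin (2 * (6 * F.L) + 1)) ×
      {μν : Fin (F.P 1).d × Fin (F.P 1).d // μν.1 < μν.2})))
      (f := fun z => (⟨fun ν => x ν + ((((z.1 ν : ℕ) : ℤ) - (6 * F.L : ℕ) : ℤ) : ZMod ((F.P 1).sitesPerDir 0)),
        z.2.1.1, z.2.1.2, z.2.2⟩ : Plaq (F.P 1) 0)))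
    rw [Finset.card_univ, Fintype.card_prod, Fintype.card_fun, Fintype.card_fin, Fintype.card_fin, hpairs] at h
    have h' : S.card ≤ (2 * (6 * F.L) + 1) ^ 3 * 3 := h
    exact_mod_cast h'
  -- THE EVENT LIES IN THE UNION OF THE BOX PLAQUETTES' LARGE-FIELD EVENTS (contrapositive of the local Prop 1)
  have hincl : {U : GaugeField (F.P 1) 0 (Matrix.specialUnitaryGroup (Fin 2) ℂ) |
        θ ≤ GaugeGroup.dist1 (GaugeField.plaqHol
          (Averaging.iter (fun i => BlockAveraging.blockAvg (P := F.P 1) (j := i) ℰp) 1 U) q)} ⊆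
      ⋃ q' ∈ S, {U | θ / (151 * (F.L : ℝ) ^ 2) ≤ GaugeGroup.dist1 (GaugeField.plaqHol U q')} := by
    intro U hU
    rw [Set.mem_setOf_eq] at hU
    by_contra hnot
    simp only [Set.mem_iUnion, Set.mem_setOf_eq, not_exists, not_le, exists_prop, not_and] at hnot
    -- the box hypothesis holds
    have hB : ∀ e : Fin (F.P 1).d → ℤ, (∀ ν, |e ν| ≤ ((6 * F.L : ℕ) : ℤ)) → ∀ (a b : Fin (F.P 1).d) (hab : a < b),
        GaugeGroup.dist1 (GaugeField.plaqHol U ⟨fun ν => x ν + ((e ν : ℤ) : ZMod ((F.P 1).sitesPerDir 0)), a, b, hab⟩) <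
          θ / (151 * (F.L : ℝ) ^ 2) := by
      intro e he a b hab
      apply hnot
      rw [hS, Finset.mem_image]
      refine ⟨(fun ν => ⟨(e ν + (6 * F.L : ℕ)).toNat, ?_⟩, ⟨(a, b), hab⟩), Finset.mem_univ _, ?_⟩
      · have h1 := abs_le.mp (he ν)
        have h2 : (e ν + (6 * F.L : ℕ)).toNat ≤ 2 * (6 * F.L) := Int.toNat_le.mpr (by push_cast; omega)
        omega
      · congr 1
        funext ν
        have h1 := abs_le.mp (he ν)
        have h2 : ((((e ν + (6 * F.L : ℕ)).toNat : ℕ) : ℤ) - (6 * F.L : ℕ) : ℤ) = e ν := by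
          rw [Int.toNat_of_nonneg (by omega)]; ring
        simp only [h2]
    have hW := loc_of_box x (6 * F.L) hB
    have hj : 0 + 1 ≤ (F.P 1).m + (F.P 1).K := by show 0 + 1 ≤ F.m + 1; omega
    have hRle : ((F.P 1).d + 3) * (F.P 1).L ≤ 6 * F.L := by show (3 + 3) * F.L ≤ 6 * F.L; omega
    have h5 : (((((F.P 1).d + 2) * (F.P 1).L : ℕ) : ℝ)) = 5 * F.L := by
      rw [show ((F.P 1).d + 2) * (F.P 1).L = 5 * F.L from rfl]; push_cast; ring
    have hguard : (((((F.P 1).d + 2) * (F.P 1).L : ℕ) : ℝ) ^ 2 / 4) * (θ / (151 * (F.L : ℝ) ^ 2)) < deltaSU (Fin 2) := by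
      have hval : (((((F.P 1).d + 2) * (F.P 1).L : ℕ) : ℝ) ^ 2 / 4) * (θ / (151 * (F.L : ℝ) ^ 2)) = 25 * θ / 604 := by
        rw [h5]
        field_simp
        ring
      rw [hval]
      calc 25 * θ / 604 ≤ 25 * 8 / 604 := by
            rw [div_le_div_iff_of_pos_right (by norm_num : (0 : ℝ) < 604)]; nlinarith
        _ < 1 / 3 := by norm_num
        _ ≤ deltaSU (Fin 2) := third_le_deltaSU_two
    have hlt := dist1_plaqHol_blockAvg_lt_loc (n := Fin 2) hj ha0 q hRle hW hguard
    have hCa : (((F.P 1).L : ℝ) ^ 2 + 6 * (((((F.P 1).d + 2) * (F.P 1).L : ℕ) : ℝ)) ^ 2) * (θ / (151 * (F.L : ℝ) ^ 2)) = θ := by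
      rw [h5, show (((F.P 1).L : ℕ) : ℝ) = F.L from rfl]
      field_simp
      ring
    rw [hCa] at hlt
    have hiter : Averaging.iter (fun i => BlockAveraging.blockAvg (P := F.P 1) (j := i) ℰp) 1 U =
        (BlockAveraging.blockAvg (P := F.P 1) (j := 0) ℰp).avg U := rfl
    rw [hiter] at hU
    exact absurd hlt (not_lt.mpr hU)
  -- EACH BOX PLAQUETTE: the chessboard single-plaquette tail at threshold `θ/(151L²)`
  have hterm : ∀ q' : Plaq (F.P 1) 0,
      (gibbsK F ℰp γ 1).real {U | θ / (151 * (F.L : ℝ) ^ 2) ≤ GaugeGroup.dist1 (GaugeField.plaqHol U q')} ≤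
        (2 * Real.exp 24 * (c ^ 3)⁻¹) * Real.sqrt ((F.scheme ℰp γ).β 1) ^ 9 *
          Real.exp (-((F.scheme ℰp γ).β 1 * (θ / (151 * (F.L : ℝ) ^ 2)) ^ 2 / 4)) := by
    intro q'
    have h := htail (F.P 1) ((F.scheme ℰp γ).β 1) hβ1 _ ha0 q'
    rw [gibbsK_eq]
    refine h.trans (le_of_eq ?_)
    have hcard : Fintype.card {q : Fin (F.P 1).d × Fin (F.P 1).d // q.1 < q.2} = 3 := by
      rw [show (F.P 1).d = 3 from rfl]; decide
    rw [hcard, show (F.P 1).d = 3 from rfl]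
    norm_num
  -- ASSEMBLY: monotonicity, union bound, the per-plaquette bound, the cardinality of the box
  have hB0 : 0 ≤ (2 * Real.exp 24 * (c ^ 3)⁻¹) * Real.sqrt ((F.scheme ℰp γ).β 1) ^ 9 *
      Real.exp (-((F.scheme ℰp γ).β 1 * (θ / (151 * (F.L : ℝ) ^ 2)) ^ 2 / 4)) := by positivity
  calc (gibbsK F ℰp γ 1).real {U | θ ≤ GaugeGroup.dist1 (GaugeField.plaqHol
          (Averaging.iter (fun i => BlockAveraging.blockAvg (P := F.P 1) (j := i) ℰp) 1 U) q)}
      ≤ (gibbsK F ℰp γ 1).real (⋃ q' ∈ S, {U | θ / (151 * (F.L : ℝ) ^ 2) ≤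
          GaugeGroup.dist1 (GaugeField.plaqHol U q')}) := measureReal_mono hincl (measure_ne_top _ _)
    _ ≤ ∑ q' ∈ S, (gibbsK F ℰp γ 1).real {U | θ / (151 * (F.L : ℝ) ^ 2) ≤
          GaugeGroup.dist1 (GaugeField.plaqHol U q')} := measureReal_biUnion_finset_le S _
    _ ≤ ∑ _q' ∈ S, (2 * Real.exp 24 * (c ^ 3)⁻¹) * Real.sqrt ((F.scheme ℰp γ).β 1) ^ 9 *
          Real.exp (-((F.scheme ℰp γ).β 1 * (θ / (151 * (F.L : ℝ) ^ 2)) ^ 2 / 4)) :=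
        Finset.sum_le_sum fun q' _ => hterm q'
    _ = S.card * ((2 * Real.exp 24 * (c ^ 3)⁻¹) * Real.sqrt ((F.scheme ℰp γ).β 1) ^ 9 *
          Real.exp (-((F.scheme ℰp γ).β 1 * (θ / (151 * (F.L : ℝ) ^ 2)) ^ 2 / 4))) := by
        rw [Finset.sum_const, nsmul_eq_mul]
    _ ≤ (((2 * (6 * F.L) + 1) ^ 3 * 3 : ℕ) : ℝ) * ((2 * Real.exp 24 * (c ^ 3)⁻¹) * Real.sqrt ((F.scheme ℰp γ).β 1) ^ 9 *
          Real.exp (-((F.scheme ℰp γ).β 1 * (θ / (151 * (F.L : ℝ) ^ 2)) ^ 2 / 4))) :=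
        mul_le_mul_of_nonneg_right hScard hB0
    _ = _ := by ring

/-- ★ **THE UNIT-PLAQUETTE TAIL OF THE ONE-STEP (0.4)-AVERAGED FIELD AT BAŁABAN'S UNIT THRESHOLD, VOLUME-UNIFORM**: for every `L`,
`b₀ > 0`, `p₀` there are `c_b > 0`, `γ₁ ∈ (0,1]`, `C_b ≥ 0`, `N_b` with
`Gibbs_1{t·θ(0) ≤ |Ū¹(∂q) − 1|} ≤ C_b·γ^{−N_b}·exp(−c_b·p(√γ)²)` for every family with block size `L`, every `0 < γ ≤ γ₁`, every coarse
plaquette `q` and every `t ∈ [1/2, 1]` (`θ(0) = √γ·p(√γ) ≤ 1` once `γ ≤ γ₁`; `β₁(tθ(0)/(151L²))²/4 = L t² p(√γ)²/(4(151L²)²)`;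
`(√β₁)⁹ ≤ β₁⁵ = L⁵γ⁻⁵`). [cite: Balaban1985UV3, (7) p.257 and (71) p.273; Balaban1985Averaging, Prop. 1 (51) p.26] -/
theorem avgPlaq_tail_firstRun (L : ℕ) (b₀ p₀ : ℝ) (hb₀ : 0 < b₀) :
    ∃ (cb γ₁ Cb : ℝ) (Nb : ℕ), 0 < cb ∧ 0 < γ₁ ∧ γ₁ ≤ 1 ∧ 0 ≤ Cb ∧
      ∀ (F : T3Family) (γ : ℝ), F.L = L → 0 < γ → γ ≤ γ₁ →
        ∀ (q : Plaq (F.P 1) 1) (t : ℝ), 1 / 2 ≤ t → t ≤ 1 →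
          (gibbsK F ℰp γ 1).real {U | t * θBal F.L γ b₀ p₀ 0 ≤ GaugeGroup.dist1 (GaugeField.plaqHol
              (Averaging.iter (fun i => BlockAveraging.blockAvg (P := F.P 1) (j := i) ℰp) 1 U) q)} ≤
            Cb * (γ⁻¹) ^ Nb * Real.exp (-(cb * B10.pFun b₀ p₀ (Real.sqrt γ) ^ 2)) := by
  by_cases hL : 1 < L
  swap
  · refine ⟨1, 1, 0, 0, one_pos, one_pos, le_rfl, le_rfl, fun F γ hF => ?_⟩
    exact absurd (hF ▸ F.hL.2) hL
  obtain ⟨c, hc, htail⟩ := avgPlaq_tail_threshold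
  obtain ⟨γ₁', hγ₁', hθle⟩ := exists_forall_θBal_le (L := L) (by omega) b₀ p₀ one_pos
  have hL0 : (0 : ℝ) < L := by exact_mod_cast (zero_lt_one.trans hL)
  -- the constants: base rate `L/(16C²)` (`C = 151L²`), prefactor `3(12L+1)³·2e²⁴c⁻³·L⁵`, power `5`
  refine ⟨(L : ℝ) / (16 * (151 * (L : ℝ) ^ 2) ^ 2), min γ₁' 1,
    (((2 * (6 * L) + 1) ^ 3 * 3 : ℕ) : ℝ) * (2 * Real.exp 24 * (c ^ 3)⁻¹) * (L : ℝ) ^ 5, 5,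
    by positivity, lt_min hγ₁' one_pos, min_le_right _ _, by positivity, ?_⟩
  intro F γ hF hγ hγ₁ q t ht1 ht2
  subst hF
  have hγ1 : γ ≤ 1 := hγ₁.trans (min_le_right _ _)
  have hγ₁'' : γ ≤ γ₁' := hγ₁.trans (min_le_left _ _)
  -- the unit threshold `θ(0) = √γ·p(√γ)`, in `[0, 1]`
  have hpf0 : 0 ≤ B10.pFun b₀ p₀ (Real.sqrt γ) :=
    B10.pFun_nonneg _ _ _ hb₀.le (Real.sqrt_pos.2 hγ) (Real.sqrt_le_one.mpr hγ1)
  have hθeq : θBal F.L γ b₀ p₀ 0 = Real.sqrt γ * B10.pFun b₀ p₀ (Real.sqrt γ) := by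
    simp only [θBal, pow_zero, mul_one]
  have hθsq : θBal F.L γ b₀ p₀ 0 ^ 2 = γ * B10.pFun b₀ p₀ (Real.sqrt γ) ^ 2 := by
    rw [hθeq, mul_pow, Real.sq_sqrt hγ.le]
  have hθ0 : 0 ≤ θBal F.L γ b₀ p₀ 0 := by rw [hθeq]; positivity
  have hθ1 : θBal F.L γ b₀ p₀ 0 ≤ 1 := hθle γ hγ hγ₁'' 0
  have ht0 : 0 ≤ t := le_trans (by norm_num) ht1
  have htθ0 : 0 ≤ t * θBal F.L γ b₀ p₀ 0 := mul_nonneg ht0 hθ0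
  have htθ8 : t * θBal F.L γ b₀ p₀ 0 ≤ 8 := by nlinarith
  -- the master bound at `θ = tθ(0)`
  have hmain := htail F γ hγ hγ1 q (t * θBal F.L γ b₀ p₀ 0) htθ0 htθ8
  refine hmain.trans ?_
  -- the inverse coupling of run `1`
  have hL1 : (1 : ℝ) ≤ F.L := by exact_mod_cast hL.le
  have hβL : (F.scheme ℰp γ).β 1 = F.L / γ := by
    rw [show (F.scheme ℰp γ).β 1 = (γ * ((F.L : ℝ)⁻¹) ^ 1)⁻¹ from rfl]
    field_simp
  have hβ1 : 1 ≤ (F.scheme ℰp γ).β 1 := by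
    rw [hβL, le_div_iff₀ hγ]; linarith
  have hβ0 : 0 ≤ (F.scheme ℰp γ).β 1 := zero_le_one.trans hβ1
  -- prefactor `(√β₁)⁹ ≤ β₁⁵ = L⁵γ⁻⁵`
  have hsqrt : Real.sqrt ((F.scheme ℰp γ).β 1) ^ 9 ≤ (F.L : ℝ) ^ 5 * (γ⁻¹) ^ 5 := by
    rw [← mul_pow, ← div_eq_mul_inv, ← hβL]
    set β := (F.scheme ℰp γ).β 1
    have hs1 : Real.sqrt β ≤ β := by
      calc Real.sqrt β ≤ Real.sqrt β * Real.sqrt β :=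
            le_mul_of_one_le_right (Real.sqrt_nonneg _) (Real.one_le_sqrt.mpr hβ1)
        _ = β := Real.mul_self_sqrt hβ0
    calc Real.sqrt β ^ 9 = (Real.sqrt β * Real.sqrt β) ^ 4 * Real.sqrt β := by ring
      _ = β ^ 4 * Real.sqrt β := by rw [Real.mul_self_sqrt hβ0]
      _ ≤ β ^ 4 * β := mul_le_mul_of_nonneg_left hs1 (pow_nonneg hβ0 4)
      _ = β ^ 5 := by ring
  -- exponent `β₁a₀²/4 = L t² p²/(4C²) ≥ (L/(16C²))·p²`
  have hexp : Real.exp (-((F.scheme ℰp γ).β 1 * (t * θBal F.L γ b₀ p₀ 0 / (151 * (F.L : ℝ) ^ 2)) ^ 2 / 4)) ≤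
      Real.exp (-((F.L : ℝ) / (16 * (151 * (F.L : ℝ) ^ 2) ^ 2) * B10.pFun b₀ p₀ (Real.sqrt γ) ^ 2)) := by
    rw [Real.exp_le_exp, neg_le_neg_iff]
    have hkey : (F.scheme ℰp γ).β 1 * (t * θBal F.L γ b₀ p₀ 0 / (151 * (F.L : ℝ) ^ 2)) ^ 2 / 4 =
        (F.L : ℝ) * t ^ 2 * B10.pFun b₀ p₀ (Real.sqrt γ) ^ 2 / (4 * (151 * (F.L : ℝ) ^ 2) ^ 2) := by
      rw [div_pow, mul_pow, hθsq, hβL]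
      field_simp
    rw [hkey, div_mul_eq_mul_div, div_le_div_iff₀ (by positivity) (by positivity)]
    have htt : (1 / 2 : ℝ) * (1 / 2) ≤ t * t := mul_le_mul ht1 ht1 (by norm_num) ht0
    have h4t : (1 : ℝ) ≤ 4 * t ^ 2 := by rw [pow_two]; linarith
    have hX : 0 ≤ 4 * ((F.L : ℝ) * B10.pFun b₀ p₀ (Real.sqrt γ) ^ 2 * (151 * (F.L : ℝ) ^ 2) ^ 2) := by positivity
    calc (F.L : ℝ) * B10.pFun b₀ p₀ (Real.sqrt γ) ^ 2 * (4 * (151 * (F.L : ℝ) ^ 2) ^ 2)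
        = 4 * ((F.L : ℝ) * B10.pFun b₀ p₀ (Real.sqrt γ) ^ 2 * (151 * (F.L : ℝ) ^ 2) ^ 2) * 1 := by ring
      _ ≤ 4 * ((F.L : ℝ) * B10.pFun b₀ p₀ (Real.sqrt γ) ^ 2 * (151 * (F.L : ℝ) ^ 2) ^ 2) * (4 * t ^ 2) :=
          mul_le_mul_of_nonneg_left h4t hX
      _ = (F.L : ℝ) * t ^ 2 * B10.pFun b₀ p₀ (Real.sqrt γ) ^ 2 * (16 * (151 * (F.L : ℝ) ^ 2) ^ 2) := by ring
  have hA : 0 ≤ (((2 * (6 * F.L) + 1) ^ 3 * 3 : ℕ) : ℝ) * (2 * Real.exp 24 * (c ^ 3)⁻¹) := by positivity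
  calc (((2 * (6 * F.L) + 1) ^ 3 * 3 : ℕ) : ℝ) * (2 * Real.exp 24 * (c ^ 3)⁻¹) * Real.sqrt ((F.scheme ℰp γ).β 1) ^ 9 *
        Real.exp (-((F.scheme ℰp γ).β 1 * (t * θBal F.L γ b₀ p₀ 0 / (151 * (F.L : ℝ) ^ 2)) ^ 2 / 4))
      ≤ (((2 * (6 * F.L) + 1) ^ 3 * 3 : ℕ) : ℝ) * (2 * Real.exp 24 * (c ^ 3)⁻¹) * ((F.L : ℝ) ^ 5 * (γ⁻¹) ^ 5) *
        Real.exp (-((F.L : ℝ) / (16 * (151 * (F.L : ℝ) ^ 2) ^ 2) * B10.pFun b₀ p₀ (Real.sqrt γ) ^ 2)) :=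
        mul_le_mul (mul_le_mul_of_nonneg_left hsqrt hA) hexp (Real.exp_nonneg _) (by positivity)
    _ = (((2 * (6 * F.L) + 1) ^ 3 * 3 : ℕ) : ℝ) * (2 * Real.exp 24 * (c ^ 3)⁻¹) * (F.L : ℝ) ^ 5 * (γ⁻¹) ^ 5 *
        Real.exp (-((F.L : ℝ) / (16 * (151 * (F.L : ℝ) ^ 2) ^ 2) * B10.pFun b₀ p₀ (Real.sqrt γ) ^ 2)) := by ring

/-- ★★ **THE (base) CONJUNCT OF `stub_localStepFloor` AT THE FIRST RUN `k₀ = 1`, IN THE STUB'S LETTERS**: for every `L, b₀ > 0, p₀`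
there are `c_b > 0` (depending on `L` only — fixed BEFORE any precision, as the stub's quantifier order requires), `N_b`, `γ₁ ∈ (0,1]`,
`C_b ≥ 0` such that for every family `F` with `F.L = L`, every `0 < γ ≤ γ₁`, every unit plaquette label `q` and every threshold
multiplier `t ∈ [1/2, 1]`:
`Gibbs_1{U | t·θ(0) ≤ |Ū¹(∂q) − 1|} ≤ C_b·(γ⁻¹)^{N_b}·exp(−c_b·p(√γ)²)`, `Ū¹ = Averaging.iter (blockAvg ℰp) 1 U` read at
`plaqShift (F.sitesPerDir_unit 1) q`.  The (step)/(slack)/(card) conjuncts of the stub are NOT addressed.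
[cite: Balaban1985UV3, (7) p.257 and (70)-(71) p.273; Balaban1985Averaging, Prop. 1 (51) p.26] -/
theorem baseClause_firstRun :
    ∀ (L : ℕ) (b₀ p₀ : ℝ), 0 < b₀ → ∃ (cb : ℝ) (Nb : ℕ) (γ₁ Cb : ℝ), 0 < cb ∧ 0 < γ₁ ∧ γ₁ ≤ 1 ∧ 0 ≤ Cb ∧
      ∀ (F : T3Family) (γ : ℝ), F.L = L → 0 < γ → γ ≤ γ₁ →
        ∀ (q : Plaq (F.P 0) 0) (t : ℝ), 1 / 2 ≤ t → t ≤ 1 →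
          (gibbsK F ℰp γ 1).real {U | t * θBal F.L γ b₀ p₀ 0 ≤ GaugeGroup.dist1 (GaugeField.plaqHol
              (Averaging.iter (fun i => BlockAveraging.blockAvg (P := F.P 1) (j := i) ℰp) 1 U)
              (plaqShift (F.sitesPerDir_unit 1) q))} ≤
            Cb * (γ⁻¹) ^ Nb * Real.exp (-(cb * B10.pFun b₀ p₀ (Real.sqrt γ) ^ 2)) := by
  intro L b₀ p₀ hb₀
  obtain ⟨cb, γ₁, Cb, Nb, hcb, hγ₁, hγ₁1, hCb, h⟩ := avgPlaq_tail_firstRun L b₀ p₀ hb₀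
  exact ⟨cb, Nb, γ₁, Cb, hcb, hγ₁, hγ₁1, hCb, fun F γ hF hγ hγγ₁ q t ht1 ht2 =>
    h F γ hF hγ hγγ₁ (plaqShift (F.sitesPerDir_unit 1) q) t ht1 ht2⟩

end Summit.QuantumFields.YangMills.Theorems.LargeFieldMassRefinementTailBaseTail

end
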